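/-
Copyright (c) 2026 the pub-hodgecm-mathlib formalisation cell (harness21).  Prover seat hodgecm-mathlib-K2Liu-p02 (g9), Track B «K2-LIT» ∕ hLiu418
#184♮, Road I v3, unit U5 «THE CLOSE», FACE-D₀ row `h2₂`: the (B1c′) TIE re-keyed on the ONE archimedean letter `hX` of F0P2-p10 (g3)'s rider
`K2LiuLinePairCayleySiegelArchZero` (chain-desk word 2026-09-05T01:08Z).  THEOREMS ONLY.
-/
import Summits.HodgeConjecture.HodgeConjecture.Theorems.K2LiuFirstTermLineLiftRankRowCayley     -- this seat: `exists_Tg_pairRep_line_lineCayley`, `…_of_lineCayley` heads (+ ★ p863332's)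
import Summits.HodgeConjecture.HodgeConjecture.Theorems.K2LiuLinePairCayleySiegelArchZero        -- F0P2-p10 (g3) rider: `map_re_map_archHom_eq_zero`, `map_im_map_archHom_eq_zero`
import HarnessLib

/-!
# K2_Liu road (hLiu418 = stmt-HodgeConjecture-24832), FACE-D₀ row `h2₂`, THE (B1c′) TIE KEYED ON `hX : X_{ι z}.map adeleFst = 0`

Cell `pub/hodgecm-mathlib` (D-0151), Track B, build stream 29; helper lane `--supports stmt-HodgeConjecture-24832 --as helper`, count-neutral.

`K2LiuFirstTermLineLiftRankRowCayley` discharges ★ p863332's model letters `Tg`, `hκ` at the line Cayley mover, leaving the archimedean-vanishing of the frame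
coordinate `X_{ι z} = (blk (ι z))₁₂` as TWO letters `hre`, `him` in quadratic (`re`∕`im`) coordinates.  F0P2-p10's rider proves that both follow from the ONE
`𝔸_L`-level letter `hX : X.map (UnitaryGroup.adeleFst L) = 0` (★ p863656 `K2LiuUnipotentChartLocal`'s `hfst` spelling).  This sequel re-keys the three heads on `hX`:
* **`exists_Tg_pairRep_line_lineCayley_of_fst`** — `∃ Tg, ∀ z Φ_∞ φ, …` (★ p863332's `hκ` binder verbatim) from `ι`, `hX`, `ρf`, `hρf`;
* **`fourierCoeffDelta_thetaLift_eq_zero_of_lineCayley_fst`**, **`h2Row_thetaSide_of_lineCayley_fst`** — ★ p863332's two heads (section variables :67–:125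
  verbatim) with `(Tg) (hκ)` replaced by `(hX) (hρf)`.
RESIDUE of FACE-D₀ `h2₂` (theta side) after this file: K2E3-p23 (g8)'s S-letters (`σ hσ hσF π hπ ψ hψ ρf b hb a ha v hu hρm βloc hherm hdet χ hχ ι hχS`),
`hX` (place-local `ι`: ★ `archPart_inclPlaceAdelic`-type fact), `hρf` (★ p863696's `∃`-package at `S z := (−⅟2) • c_{q_{ι z}}`, ★ p863869's explicit `cMat`).

No definition, no instance, no notation, no named-fact hypothesis, no `sorry`; axioms ⊆ {propext, Classical.choice, Quot.sound}.  HONEST LABEL: HC_CM is proved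
only modulo the 7 printed citations (2 remaining named inputs: hLiu418 = stmt-HodgeConjecture-24832, h413 = stmt-HodgeConjecture-24833) until rung 0 closes; this file
moves no counter.

References: [Weil1964] A. Weil, Acta Math. 111 (1964), Chap. I n° 13 p. 160, n° 34 p. 184, Chap. III n° 40–41 pp. 190–193; [Kudla1994] §3; [Rallis1984] §4;
[KudlaRallis1994] §3; [Liu2021] App. B Prop. B.8 p. 104.
-/

set_option autoImplicit false
set_option linter.dupNamespace false
-- the line-pair carriers elaborate to very large types; elaborate sequentially (as in ★ `K2LiuFirstTermLineLiftRankRowModelConj`)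
set_option Elab.async false

noncomputable section

open NumberField NumberField.mixedEmbedding MeasureTheory IsDedekindDomain
open scoped Matrix ComplexOrder ENNReal TensorProduct SchwartzMap Classical  -- `Classical`: as ★ p863332

namespace Summit.HodgeConjecture.HodgeConjecture.Cruxes.HLiu418.K2LiuFirstTermLineLiftRankRowCayleyFst

open Literature.NumberTheory.Automorphic Literature.NumberTheory.Automorphic.UnitaryGroup
open Literature.NumberTheory.Automorphic.UnitaryGroup.QuadraticCoordinates
open Literature.NumberTheory.Automorphic.IdeleClassGroup
open Literature.NumberTheory.Automorphic.Liu2021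
open Literature.NumberTheory.Automorphic.Liu2021.Def411WeilCarriers
open Literature.NumberTheory.Automorphic.Liu2021.Def411WeilCarriersDoubling
open Literature.NumberTheory.GelbartRogawski1991 Literature.NumberTheory.GelbartRogawski1991.UnitaryDualPair
open Literature.NumberTheory.GelbartRogawski1991.GRConstruction
open Literature.NumberTheory.GaloisRepresentations
open Literature.NumberTheory.Weil1964
open Literature.RepresentationTheory Literature.RepresentationTheory.Liu2021
open Literature.RepresentationTheory.HeisenbergGroup
open Literature.NumberTheory.K2Lit.DoubledLineTheta Literature.NumberTheory.K2Lit.SiegelDoubled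
open Literature.MeasureTheory.Group
open Summit.HodgeConjecture.HodgeConjecture.Cruxes.HLiu418.K2LiuSiegelUnipotentFourierDefs
open Summit.HodgeConjecture.HodgeConjecture.Cruxes.HLiu418.K2LiuSiegelUnipotentCharacters
open Summit.HodgeConjecture.HodgeConjecture.Cruxes.HLiu418.K2LiuUnipotentCoveringWeight
open Summit.HodgeConjecture.HodgeConjecture.Cruxes.HLiu418.K2LiuFirstTermLineLiftRankRow
open Summit.HodgeConjecture.HodgeConjecture.Cruxes.HLiu418.K2LiuFirstTermLineLiftRankRowModelConj
  (fourierCoeffDelta_thetaLift_eq_zero_of_finLineModel_conj h2Row_thetaSide_of_finLineModel_conj)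
open Summit.HodgeConjecture.HodgeConjecture.Cruxes.HLiu418.K2LiuLinePairCayleySiegel (lineCayleyMover_mem_symplecticGroup)
open Summit.HodgeConjecture.HodgeConjecture.Cruxes.HLiu418.K2LiuLinePairCayleySiegelArchZero (map_re_map_archHom_eq_zero map_im_map_archHom_eq_zero)
open Summit.HodgeConjecture.HodgeConjecture.Cruxes.HLiu418.K2LiuFirstTermLineLiftRankRowCayley (exists_Tg_pairRep_line_lineCayley)

/-! ## §1 The `hκ` shape keyed on `hX` -/

section Shape

variable (L : Type) [Field L] [NumberField L] [IsCMField L]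
variable {N M n : ℕ} (e : Fin N × Fin M ≃ Fin n)
  (dV : Fin N → L) (hdV : ∀ i, IsCMField.complexConj L (dV i) = dV i)
  (dW : Fin M → L) (hdW : ∀ i, IsCMField.complexConj L (dW i) = dW i)
  {n'' : ℕ} (e₁ : Fin (n + n) × Fin 1 ≃ Fin n'') (hdV0 : ∀ i, dV i ≠ 0) (hdW0 : ∀ i, dW i ≠ 0)
  (lam : IdeleClassGroup L →ₜ* Circle) (hlam : IsConjugateSymplectic L lam) (a' : (Fp L)ˣ)

set_option maxHeartbeats 1000000 in -- the statement carries the line datum's `toSp` term (default RED measured, as ★ p863869 ∕ this seat's TIE file)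
/-- **THE `hκ` LETTER OF ★ p863332 AT THE LINE CAYLEY MOVER, keyed on `hX`**: for an index map `ι : Z → N_Δ(𝔸)` whose frame coordinates have zero archimedean part
(`hX`, F0P2-p10's rider ⇒ `hre`, `him`) and `hρf : ρf z φ = ψ_f(q_{(S z)_f}) · φ`, `S z := (−⅟2) • c_{q_{ι z}}`: `∃ Tg, ∀ z Φ_∞ φ, Tg (ω(toDiagA (ι z), 1) (Tg⁻¹ (Φ_∞ ⊗ φ)))
= Φ_∞ ⊗ ρf z φ`. [cite: Weil1964, Chap. I n° 13 p. 160, n° 34 p. 184; Chap. III n° 40–41 pp. 190–193] [cite: Kudla1994, §3] [cite: Liu2021, App. B Prop. B.8 p. 104] -/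
theorem exists_Tg_pairRep_line_lineCayley_of_fst {Z : Type*} [Group Z] (ι : Z → ↥(unipDelta L e dV hdV dW hdW))
    (hX : ∀ z, ((blk L e dV hdV dW hdW ((ι z : ↥(unipDelta L e dV hdV dW hdW)) : HA L e dV hdV dW hdW)).toBlocks₁₂).map (UnitaryGroup.adeleFst L) = 0)
    (ρf : Representation ℂ Z (FinSB (Fp L) (Fin n'')))
    (hρf : ∀ (z : Z) (φ : FinSB (Fp L) (Fin n'')), ρf z φ =
      finMulLM (finSdChar ((((-⅟(2 : AdeleRing (𝓞 (Fp L)) (Fp L))) • SiegelParabolicPi.cMat (ratSp (Fp L) (adelicGram (Fp L) e₁ (realDiagonal L (dD L e dV hdV dW hdW) (dD_conj L e dV hdV dW hdW)) (TW (Fp L) a'))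
          (isUnit_det_adelicGram (Fp L) e₁
            (isUnit_det_realDiagonal L (dD L e dV hdV dW hdW) (dD_conj L e dV hdV dW hdW) (dD_ne_zero L e dV hdV dW hdW hdV0 hdW0))
            (isUnit_det_TW (Fp L) a')) (⟨_, lineCayleyMover_mem_symplecticGroup (Fp L) n ((Equiv.prodUnique (Fin (n + n)) (Fin 1)).symm.trans e₁) (Units.mul_inv a')⟩ :
            Matrix.symplecticGroup (Fin n'') (Fp L)) *
        toSp (Fp L) L (IsCMField.complexConj L) (n + n) 1 e₁ (Matrix.diagonal (dD L e dV hdV dW hdW)) (JW (Fp L) L a')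
          (complexConj_imagUnit L) (imagUnit_ne_zero L) (imagUnit_mul_self L)
          (realDiagonal_isSymm L (dD L e dV hdV dW hdW) (dD_conj L e dV hdV dW hdW)) (isSymm_TW (Fp L) a')
          (realDiagonal_map L (dD L e dV hdV dW hdW) (dD_conj L e dV hdV dW hdW)).symm (JW_eq (Fp L) L a')
          (UnitaryGroup.adelicInl (Fp L) L (IsCMField.complexConj L) (n + n) 1 (Matrix.diagonal (dD L e dV hdV dW hdW)) (JW (Fp L) L a')
            (toDiagA L e dV hdV dW hdW ((ι z : ↥(unipDelta L e dV hdV dW hdW)) : HA L e dV hdV dW hdW))) *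
        (ratSp (Fp L) (adelicGram (Fp L) e₁ (realDiagonal L (dD L e dV hdV dW hdW) (dD_conj L e dV hdV dW hdW)) (TW (Fp L) a'))
          (isUnit_det_adelicGram (Fp L) e₁
            (isUnit_det_realDiagonal L (dD L e dV hdV dW hdW) (dD_conj L e dV hdV dW hdW) (dD_ne_zero L e dV hdV dW hdW hdV0 hdW0))
            (isUnit_det_TW (Fp L) a')) (⟨_, lineCayleyMover_mem_symplecticGroup (Fp L) n ((Equiv.prodUnique (Fin (n + n)) (Fin 1)).symm.trans e₁) (Units.mul_inv a')⟩ :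
            Matrix.symplecticGroup (Fin n'') (Fp L)))⁻¹))).map
        (RingHom.snd (InfiniteAdeleRing (Fp L)) (FiniteAdeleRing (𝓞 (Fp L)) (Fp L))))) (isLocallyConstant_finSdChar _) φ) :
    ∃ Tg : ↥(piSchwartzBruhat (Fp L) (Fin n'')) ≃ₗ[ℂ] ↥(piSchwartzBruhat (Fp L) (Fin n'')),
      ∀ (z : Z) (Φinf : 𝓢((Fin n'' → mixedSpace (Fp L)), ℂ)) (φ : FinSB (Fp L) (Fin n'')),
        Tg (pairRep (Fp L) L (IsCMField.complexConj L) (n + n) 1 e₁ (Matrix.diagonal (dD L e dV hdV dW hdW)) (JW (Fp L) L a')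
            (chiSplittingLine L e₁ (dD L e dV hdV dW hdW) (dD_conj L e dV hdV dW hdW) (dD_ne_zero L e dV hdV dW hdW hdV0 hdW0)
              (toHeckeCharacter L lam) (isUnitary_toHeckeCharacter L lam)
              ((isOscillatorChar_toHeckeCharacter_iff lam).mpr hlam) (TW (Fp L) a')
              (isUnit_det_TW (Fp L) a') (JW (Fp L) L a') (JW_eq (Fp L) L a'))
            (toDiagA L e dV hdV dW hdW ((ι z : unipDelta L e dV hdV dW hdW) : HA L e dV hdV dW hdW), 1)
            (Tg.symm (piSchwartzBruhatEquiv (Fp L) (Fin n'') (Φinf ⊗ₜ[ℂ] φ)))) =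
          piSchwartzBruhatEquiv (Fp L) (Fin n'') (Φinf ⊗ₜ[ℂ] ρf z φ) :=
  exists_Tg_pairRep_line_lineCayley L e dV hdV dW hdW e₁ hdV0 hdW0 lam hlam a' ι
    (fun z => map_re_map_archHom_eq_zero L _ (hX z)) (fun z => map_im_map_archHom_eq_zero L _ (hX z)) ρf hρf

end Shape

/-! ## §2 ★ p863332's heads with `Tg`, `hκ` replaced by `hX`, `hρf` (section variables :67–:125 of ★ p863332 verbatim) -/

section Tie


variable (L : Type) [Field L] [NumberField L] [IsCMField L]
variable {N n : ℕ} (e : Fin N × Fin 1 ≃ Fin n)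
  (dV : Fin N → L) (hdV : ∀ i, IsCMField.complexConj L (dV i) = dV i)
  (dW : Fin 1 → L) (hdW : ∀ i, IsCMField.complexConj L (dW i) = dW i)
  {n'' : ℕ} (e₁ : Fin (n + n) × Fin 1 ≃ Fin n'')
  (hdV0 : ∀ i, dV i ≠ 0) (hdW0 : ∀ i, dW i ≠ 0)
  (lam : IdeleClassGroup L →ₜ* Circle) (hlam : IsConjugateSymplectic L lam) (a' : (Fp L)ˣ)
  (hρ : HasThetaMajorants fun
      (p : ↥(UnitaryGroup.adelic (Fp L) L (IsCMField.complexConj L) (n + n) (Matrix.diagonal (dD L e dV hdV dW hdW))) ×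
        ↥(UnitaryGroup.adelic (Fp L) L (IsCMField.complexConj L) 1 (JW (Fp L) L a')))
      (Φ : piSchwartzBruhat (Fp L) (Fin n'')) =>
        pairRep (Fp L) L (IsCMField.complexConj L) (n + n) 1 e₁ (Matrix.diagonal (dD L e dV hdV dW hdW)) (JW (Fp L) L a')
          (chiSplittingLine L e₁ (dD L e dV hdV dW hdW) (dD_conj L e dV hdV dW hdW) (dD_ne_zero L e dV hdV dW hdW hdV0 hdW0)
            (toHeckeCharacter L lam) (isUnitary_toHeckeCharacter L lam)
            ((isOscillatorChar_toHeckeCharacter_iff lam).mpr hlam) (TW (Fp L) a')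
            (isUnit_det_TW (Fp L) a') (JW (Fp L) L a') (JW_eq (Fp L) L a'))
          p Φ)
  [MeasurableSpace (↥(UnitaryGroup.adelic (Fp L) L (IsCMField.complexConj L) 1 (JW (Fp L) L a')) ⧸
    (UnitaryGroup.toAdelic (Fp L) L (IsCMField.complexConj L) 1 (JW (Fp L) L a')).range)]
  [BorelSpace (↥(UnitaryGroup.adelic (Fp L) L (IsCMField.complexConj L) 1 (JW (Fp L) L a')) ⧸
    (UnitaryGroup.toAdelic (Fp L) L (IsCMField.complexConj L) 1 (JW (Fp L) L a')).range)]
  (μW : Measure (↥(UnitaryGroup.adelic (Fp L) L (IsCMField.complexConj L) 1 (JW (Fp L) L a')) ⧸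
    (UnitaryGroup.toAdelic (Fp L) L (IsCMField.complexConj L) 1 (JW (Fp L) L a')).range)) [IsFiniteMeasure μW]
  (fw : C(↥(UnitaryGroup.adelic (Fp L) L (IsCMField.complexConj L) 1 (JW (Fp L) L a')) ⧸
    (UnitaryGroup.toAdelic (Fp L) L (IsCMField.complexConj L) 1 (JW (Fp L) L a')).range, ℂ))
  [MeasurableSpace (unipDelta L e dV hdV dW hdW)] [BorelSpace (unipDelta L e dV hdV dW hdW)]
  (νN : Measure (unipDelta L e dV hdV dW hdW)) [νN.IsMulLeftInvariant]
  {βw : unipDelta L e dV hdV dW hdW → ℝ≥0∞} (hβ : IsCoveringWeight (unipDeltaRat L e dV hdV dW hdW) βw) (hβtop : ∫⁻ u, βw u ∂νN ≠ ∞)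
  (S : Matrix (Fin n) (Fin n) L)

/-! ## The letters: linear readings of the lift and of the coefficient, and the σ-explicit line model on `𝒮(𝔸_f^{n″})` -/

variable
  -- (i) ★ (t): the lift as a linear map of `Φ`, and ★ (c): the coefficient as a linear map on a class `P ∋ Bl Φ`
  (Bl : ↥(piSchwartzBruhat (Fp L) (Fin n'')) →ₗ[ℂ] (HA L e dV hdV dW hdW → ℂ))
  (hBl : ∀ (Φ : piSchwartzBruhat (Fp L) (Fin n'')) (h : HA L e dV hdV dW hdW),
    Bl Φ h = doubledLineThetaLift L e dV hdV dW hdW e₁ hdV0 hdW0 lam hlam a' hρ μW Φ fw h)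
  (P : Submodule ℂ (HA L e dV hdV dW hdW → ℂ)) (hPB : ∀ Φ, Bl Φ ∈ P) (cfS : ↥P →ₗ[ℂ] (HA L e dV hdV dW hdW → ℂ))
  (hcf : ∀ (y : ↥P) (h : HA L e dV hdV dW hdW), cfS y h = fourierCoeffDelta L e dV hdV dW hdW νN βw S (y : HA L e dV hdV dW hdW → ℂ) h)
  -- (ii) the σ-explicit line model at one finite place, on the finite-adelic Schwartz–Bruhat space (★ U2a §1′ binders verbatim)
  {R : Type*} [CommRing R] {F : Type*} [Field F] [Algebra F R]
  (σ : R →+* R) (hσ : ∀ x, σ (σ x) = x) (hσF : ∀ c : F, σ (algebraMap F R c) = algebraMap F R c)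
  (π : Matrix (Fin 2) (Fin 2) R →ₗ[F] Matrix (Fin 2) (Fin 2) R →ₗ[F] F)
  (hπ : ∀ H : Matrix (Fin 2) (Fin 2) R, (H.map σ)ᵀ = H → H ≠ 0 → ∃ s : Matrix (Fin 2) (Fin 2) R, (s.map σ)ᵀ = s ∧ π s H ≠ 0)
  (ψ : AddChar F Circle) (hψ : ∃ t : F, ((ψ t : Circle) : ℂ) ≠ 1)
  {Z : Type*} [Group Z] (ρf : Representation ℂ Z (FinSB (Fp L) (Fin n'')))
  (b : Z → Matrix (Fin 2) (Fin 2) R) (hb : ∀ s : Matrix (Fin 2) (Fin 2) R, (s.map σ)ᵀ = s → ∃ z, b z = s)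
  (a : R) (ha : σ a = a) (v : (Fin n'' → FiniteAdeleRing (𝓞 (Fp L)) (Fp L)) → Fin 2 → R)
  (hu : ∀ z, IsLocallyConstant fun x => ((ψ (π (b z) (a • Matrix.vecMulVec (⇑σ ∘ v x) (v x))) : Circle) : ℂ))
  (hρm : ∀ (z : Z) (φ : FinSB (Fp L) (Fin n'')),
    ((ρf z φ : FinSB (Fp L) (Fin n'')) : (Fin n'' → FiniteAdeleRing (𝓞 (Fp L)) (Fp L)) → ℂ) =
      (fun x => ((ψ (π (b z) (a • Matrix.vecMulVec (⇑σ ∘ v x) (v x))) : Circle) : ℂ)) * φ)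
  (βloc : Matrix (Fin 2) (Fin 2) R) (hherm : (βloc.map σ)ᵀ = βloc) (hdet : βloc.det ≠ 0)
  (χ : Z →* ℂˣ) (hχ : ∀ z, ((χ z : ℂˣ) : ℂ) = ((ψ (π (b z) βloc) : Circle) : ℂ))
  -- (iii) the embedding `ι : Z → N_Δ(𝔸)` and the character match `χ = ψ_S ∘ ι` (the Weil∕model letter itself is `hκ` in the heads below)
  (ι : Z → unipDelta L e dV hdV dW hdW)
  (hχS : ∀ z : Z, ((χ z : ℂˣ) : ℂ) = (unipDeltaChar L e dV hdV dW hdW S (((ι z : unipDelta L e dV hdV dW hdW)) : HA L e dV hdV dW hdW) : ℂ))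

include hBl hPB hcf hβ hβtop hσ hσF hπ hψ hb ha hu hρm hherm hdet hχ hχS


set_option maxHeartbeats 1000000 in -- idem
/-- **`Λ_S ≡ 0` AT THE LINE CAYLEY MOVER, keyed on `hX`.** [cite: Rallis1984, §4] [cite: KudlaRallis1994, §3] [cite: Weil1964, Chap. I n° 13, Chap. III n° 37–38] -/
theorem fourierCoeffDelta_thetaLift_eq_zero_of_lineCayley_fst
    (hX : ∀ z, ((blk L e dV hdV dW hdW ((ι z : ↥(unipDelta L e dV hdV dW hdW)) : HA L e dV hdV dW hdW)).toBlocks₁₂).map (UnitaryGroup.adeleFst L) = 0)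
    (hρf : ∀ (z : Z) (φ : FinSB (Fp L) (Fin n'')), ρf z φ =
      finMulLM (finSdChar ((((-⅟(2 : AdeleRing (𝓞 (Fp L)) (Fp L))) • SiegelParabolicPi.cMat (ratSp (Fp L) (adelicGram (Fp L) e₁ (realDiagonal L (dD L e dV hdV dW hdW) (dD_conj L e dV hdV dW hdW)) (TW (Fp L) a'))
          (isUnit_det_adelicGram (Fp L) e₁
            (isUnit_det_realDiagonal L (dD L e dV hdV dW hdW) (dD_conj L e dV hdV dW hdW) (dD_ne_zero L e dV hdV dW hdW hdV0 hdW0))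
            (isUnit_det_TW (Fp L) a')) (⟨_, lineCayleyMover_mem_symplecticGroup (Fp L) n ((Equiv.prodUnique (Fin (n + n)) (Fin 1)).symm.trans e₁) (Units.mul_inv a')⟩ :
            Matrix.symplecticGroup (Fin n'') (Fp L)) *
        toSp (Fp L) L (IsCMField.complexConj L) (n + n) 1 e₁ (Matrix.diagonal (dD L e dV hdV dW hdW)) (JW (Fp L) L a')
          (complexConj_imagUnit L) (imagUnit_ne_zero L) (imagUnit_mul_self L)
          (realDiagonal_isSymm L (dD L e dV hdV dW hdW) (dD_conj L e dV hdV dW hdW)) (isSymm_TW (Fp L) a')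
          (realDiagonal_map L (dD L e dV hdV dW hdW) (dD_conj L e dV hdV dW hdW)).symm (JW_eq (Fp L) L a')
          (UnitaryGroup.adelicInl (Fp L) L (IsCMField.complexConj L) (n + n) 1 (Matrix.diagonal (dD L e dV hdV dW hdW)) (JW (Fp L) L a')
            (toDiagA L e dV hdV dW hdW ((ι z : ↥(unipDelta L e dV hdV dW hdW)) : HA L e dV hdV dW hdW))) *
        (ratSp (Fp L) (adelicGram (Fp L) e₁ (realDiagonal L (dD L e dV hdV dW hdW) (dD_conj L e dV hdV dW hdW)) (TW (Fp L) a'))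
          (isUnit_det_adelicGram (Fp L) e₁
            (isUnit_det_realDiagonal L (dD L e dV hdV dW hdW) (dD_conj L e dV hdV dW hdW) (dD_ne_zero L e dV hdV dW hdW hdV0 hdW0))
            (isUnit_det_TW (Fp L) a')) (⟨_, lineCayleyMover_mem_symplecticGroup (Fp L) n ((Equiv.prodUnique (Fin (n + n)) (Fin 1)).symm.trans e₁) (Units.mul_inv a')⟩ :
            Matrix.symplecticGroup (Fin n'') (Fp L)))⁻¹))).map
        (RingHom.snd (InfiniteAdeleRing (Fp L)) (FiniteAdeleRing (𝓞 (Fp L)) (Fp L))))) (isLocallyConstant_finSdChar _) φ)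
    (Φ : piSchwartzBruhat (Fp L) (Fin n'')) :
    fourierCoeffDelta L e dV hdV dW hdW νN βw S (doubledLineThetaLift L e dV hdV dW hdW e₁ hdV0 hdW0 lam hlam a' hρ μW Φ fw) 1 = 0 := by
  obtain ⟨Tg, hκ⟩ := exists_Tg_pairRep_line_lineCayley_of_fst L e dV hdV dW hdW e₁ hdV0 hdW0 lam hlam a' ι hX ρf hρf
  exact fourierCoeffDelta_thetaLift_eq_zero_of_finLineModel_conj L e dV hdV dW hdW e₁ hdV0 hdW0 lam hlam a' hρ μW fw νN hβ hβtop S Bl hBl P hPB cfS hcf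
    σ hσ hσF π hπ ψ hψ ρf b hb a ha v hu hρm βloc hherm hdet χ hχ ι hχS Tg hκ Φ

set_option maxHeartbeats 1000000 in -- idem
/-- **ROW `h2₂` OF FACE-D′ FOR THE THETA SIDE AT THE LINE CAYLEY MOVER, keyed on `hX`.** [cite: Rallis1984, §4] [cite: KudlaRallis1994, §3] [cite: Liu2021, App. B Prop. B.8 p. 104] -/
theorem h2Row_thetaSide_of_lineCayley_fst
    (hX : ∀ z, ((blk L e dV hdV dW hdW ((ι z : ↥(unipDelta L e dV hdV dW hdW)) : HA L e dV hdV dW hdW)).toBlocks₁₂).map (UnitaryGroup.adeleFst L) = 0)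
    (hρf : ∀ (z : Z) (φ : FinSB (Fp L) (Fin n'')), ρf z φ =
      finMulLM (finSdChar ((((-⅟(2 : AdeleRing (𝓞 (Fp L)) (Fp L))) • SiegelParabolicPi.cMat (ratSp (Fp L) (adelicGram (Fp L) e₁ (realDiagonal L (dD L e dV hdV dW hdW) (dD_conj L e dV hdV dW hdW)) (TW (Fp L) a'))
          (isUnit_det_adelicGram (Fp L) e₁
            (isUnit_det_realDiagonal L (dD L e dV hdV dW hdW) (dD_conj L e dV hdV dW hdW) (dD_ne_zero L e dV hdV dW hdW hdV0 hdW0))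
            (isUnit_det_TW (Fp L) a')) (⟨_, lineCayleyMover_mem_symplecticGroup (Fp L) n ((Equiv.prodUnique (Fin (n + n)) (Fin 1)).symm.trans e₁) (Units.mul_inv a')⟩ :
            Matrix.symplecticGroup (Fin n'') (Fp L)) *
        toSp (Fp L) L (IsCMField.complexConj L) (n + n) 1 e₁ (Matrix.diagonal (dD L e dV hdV dW hdW)) (JW (Fp L) L a')
          (complexConj_imagUnit L) (imagUnit_ne_zero L) (imagUnit_mul_self L)
          (realDiagonal_isSymm L (dD L e dV hdV dW hdW) (dD_conj L e dV hdV dW hdW)) (isSymm_TW (Fp L) a')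
          (realDiagonal_map L (dD L e dV hdV dW hdW) (dD_conj L e dV hdV dW hdW)).symm (JW_eq (Fp L) L a')
          (UnitaryGroup.adelicInl (Fp L) L (IsCMField.complexConj L) (n + n) 1 (Matrix.diagonal (dD L e dV hdV dW hdW)) (JW (Fp L) L a')
            (toDiagA L e dV hdV dW hdW ((ι z : ↥(unipDelta L e dV hdV dW hdW)) : HA L e dV hdV dW hdW))) *
        (ratSp (Fp L) (adelicGram (Fp L) e₁ (realDiagonal L (dD L e dV hdV dW hdW) (dD_conj L e dV hdV dW hdW)) (TW (Fp L) a'))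
          (isUnit_det_adelicGram (Fp L) e₁
            (isUnit_det_realDiagonal L (dD L e dV hdV dW hdW) (dD_conj L e dV hdV dW hdW) (dD_ne_zero L e dV hdV dW hdW hdV0 hdW0))
            (isUnit_det_TW (Fp L) a')) (⟨_, lineCayleyMover_mem_symplecticGroup (Fp L) n ((Equiv.prodUnique (Fin (n + n)) (Fin 1)).symm.trans e₁) (Units.mul_inv a')⟩ :
            Matrix.symplecticGroup (Fin n'') (Fp L)))⁻¹))).map
        (RingHom.snd (InfiniteAdeleRing (Fp L)) (FiniteAdeleRing (𝓞 (Fp L)) (Fp L))))) (isLocallyConstant_finSdChar _) φ)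
    {D : Type*} [AddCommGroup D] [Module ℂ D] (𝓣 : D →ₗ[ℂ] piSchwartzBruhat (Fp L) (Fin n''))
    (T₂ : D →ₗ[ℂ] (HA L e dV hdV dW hdW → ℂ))
    (hT₂B : ∀ (x : D) (h : HA L e dV hdV dW hdW),
      T₂ x h = doubledLineThetaLift L e dV hdV dW hdW e₁ hdV0 hdW0 lam hlam a' hρ μW (𝓣 x) fw h)
    (hP₂ : ∀ x, T₂ x ∈ P) :
    cfS ∘ₗ LinearMap.codRestrict P T₂ hP₂ = 0 := by
  obtain ⟨Tg, hκ⟩ := exists_Tg_pairRep_line_lineCayley_of_fst L e dV hdV dW hdW e₁ hdV0 hdW0 lam hlam a' ι hX ρf hρf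
  exact h2Row_thetaSide_of_finLineModel_conj L e dV hdV dW hdW e₁ hdV0 hdW0 lam hlam a' hρ μW fw νN hβ hβtop S Bl hBl P hPB cfS hcf
    σ hσ hσF π hπ ψ hψ ρf b hb a ha v hu hρm βloc hherm hdet χ hχ ι hχS Tg hκ 𝓣 T₂ hT₂B hP₂

end Tie

end Summit.HodgeConjecture.HodgeConjecture.Cruxes.HLiu418.K2LiuFirstTermLineLiftRankRowCayleyFst

end
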